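import Literature.Geometry.DiscreteGeometry.KissingFanTriangleSets
import Literature.Geometry.DiscreteGeometry.SphericalCodeHullVertexLink
import Summits.AtomisticToContinuum.Crystallization.Theorems.GappedShellCensusShellTrichotomyStubBondHullEdge
import Summits.AtomisticToContinuum.Crystallization.Theorems.GappedShellCensusShellTrichotomyStubBondTriangleFacet

/-!
# `ChargedEnergyGap` · the CHART DIAL, part Z: THE LABELLED FAN TRIANGULATION OF A BONDED UNIT CODE
(decomp-a2c lens-3 g39 node «ChargeFreeGap»; seventh input of the [G] port plan — the ABSTRACT form of the landed
`GappedShellCensusShellTrichotomyStubFanStruct.stub_fanStruct`, stated over the inner-product dictionary of part W)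

`fanStruct_of_code`: let `u : Fin 12 → ℝ³` be an injective family of unit vectors and `bond` a relation with
`⟪u k, u l⟫ ≤ 2801/5202` for `k ≠ l`, `2201/4802 ≤ ⟪u k, u l⟫` for bonded `k, l`, and assume
`0 ∈ interior (convexHull ℝ (range u))` (part X gives this from "four bonds per label").  Let `X = {u k}` and let `tri`
be the set of label sets `S ⊆ Fin 12` with `S.image u ∈ fanTriSets X` (the fan-refined hull triangulation pulled back
along the labelling).  Then: every triple of `tri` has three labels; `tri` has twenty triples; every side of a
triple lies in exactly two triples; every BOND is a side of exactly two triples; every BONDED triangle is a triple; and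
the link of every label is connected in the closure sense of `fanTriSets_link`.

The transport section is the tree's VERBATIM (its private lemmas were already stated over `(u, X, tri)` with the two
cosine constants; geometric inputs the tree's `stub_bondHullEdge` / `stub_bondTriangleFacet` (gapped route), `card_fanTriSets`,
`card_filter_fanTriSets_eq_two(_of_mem_hullEdges)`, `fanTriSets_link` BY NAME); only the final assembly changes: the
gapped dictionary `shell_facts` and `stub_originInterior` become the hypotheses `hu1, hu, hhi, hlo, h0`, and
"`dist ≤ 1·02`" becomes "`bond`".  No `sorry`, no new axiom, no instance / notation / option; no new definitions.
-/

noncomputable section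

namespace Summit.AtomisticToContinuum.Crystallization.Theorems.ChargedEnergyGapChartDial

open Literature.Geometry.DiscreteGeometry
open scoped RealInnerProductSpace

/-! ### Transport along the labelling -/

section Transport

variable {u : Fin 12 → EuclideanSpace ℝ (Fin 3)} {X : Finset (EuclideanSpace ℝ (Fin 3))}
  {tri : Finset (Finset (Fin 12))}

/-- The labelled points are points of `X`. -/
private theorem apply_mem (hX : X = Finset.univ.image u) (k : Fin 12) : u k ∈ X := by
  rw [hX]
  exact Finset.mem_image_of_mem u (Finset.mem_univ k)

/-- `X` consists of unit vectors. -/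
private theorem norm_eq_one_of_mem (hu1 : ∀ k, ‖u k‖ = 1) (hX : X = Finset.univ.image u) :
    ∀ y ∈ X, ‖y‖ = 1 := by
  subst hX
  intro y hy
  obtain ⟨k, -, rfl⟩ := Finset.mem_image.1 hy
  exact hu1 k

/-- Distinct points of `X` have inner product `≤ 2801/5202`. -/
private theorem inner_le_of_mem (hhi : ∀ k l, k ≠ l → ⟪u k, u l⟫ ≤ 2801 / 5202)
    (hX : X = Finset.univ.image u) : ∀ y ∈ X, ∀ y' ∈ X, y ≠ y' → ⟪y, y'⟫ ≤ 2801 / 5202 := by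
  subst hX
  intro y hy y' hy' hne
  obtain ⟨k, -, rfl⟩ := Finset.mem_image.1 hy
  obtain ⟨l, -, rfl⟩ := Finset.mem_image.1 hy'
  exact hhi k l fun h => hne (congrArg u h)

/-- A fan triangle of `X` is the image of a label triple of `tri`. -/
private theorem exists_image_eq_of_mem (hX1 : ∀ y ∈ X, ‖y‖ = 1) (hX : X = Finset.univ.image u)
    (htri : ∀ S, S ∈ tri ↔ S.image u ∈ fanTriSets X) {T : Finset (EuclideanSpace ℝ (Fin 3))}
    (hT : T ∈ fanTriSets X) : ∃ S ∈ tri, S.image u = T := by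
  have hTX : T ⊆ Finset.univ.image u := hX ▸ subset_of_mem_fanTriSets hX1 hT
  obtain ⟨S, rfl⟩ := Finset.subset_univ_image_iff.1 hTX
  exact ⟨S, (htri S).2 hT, rfl⟩

/-- `S ↦ S.image u` maps `tri` onto `fanTriSets X`. -/
private theorem image_tri (hX1 : ∀ y ∈ X, ‖y‖ = 1) (hX : X = Finset.univ.image u)
    (htri : ∀ S, S ∈ tri ↔ S.image u ∈ fanTriSets X) :
    tri.image (Finset.image u) = fanTriSets X := by
  ext T
  rw [Finset.mem_image]
  constructor
  · rintro ⟨S, hS, rfl⟩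
    exact (htri S).1 hS
  · intro hT
    obtain ⟨S, hS, rfl⟩ := exists_image_eq_of_mem hX1 hX htri hT
    exact ⟨S, hS, rfl⟩

/-- Counting the triples through a label set `s` is counting the fan triangles through
`s.image u`. -/
private theorem card_filter_tri (hu : Function.Injective u) (hX1 : ∀ y ∈ X, ‖y‖ = 1)
    (hX : X = Finset.univ.image u) (htri : ∀ S, S ∈ tri ↔ S.image u ∈ fanTriSets X)
    (s : Finset (Fin 12)) :
    (tri.filter fun S' => s ⊆ S').card =
      ((fanTriSets X).filter fun T => s.image u ⊆ T).card := by
  rw [← Finset.card_image_of_injective (tri.filter fun S' => s ⊆ S') (Finset.image_injective hu)]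
  congr 1
  ext T
  simp only [Finset.mem_image, Finset.mem_filter]
  constructor
  · rintro ⟨S, ⟨hS, hsS⟩, rfl⟩
    exact ⟨(htri S).1 hS, Finset.image_subset_image hsS⟩
  · rintro ⟨hT, hsT⟩
    obtain ⟨S, hS, rfl⟩ := exists_image_eq_of_mem hX1 hX htri hT
    exact ⟨S, ⟨hS, (Finset.image_subset_image_iff hu).1 hsT⟩, rfl⟩

/-- Field 1: every triple has three labels. -/
private theorem card_eq_three_of_mem_tri (hu : Function.Injective u) (hX1 : ∀ y ∈ X, ‖y‖ = 1)
    (htri : ∀ S, S ∈ tri ↔ S.image u ∈ fanTriSets X) : ∀ S ∈ tri, S.card = 3 := by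
  intro S hS
  rw [← Finset.card_image_of_injective S hu]
  exact card_eq_three_of_mem_fanTriSets hX1 ((htri S).1 hS)

/-- Field 2: twenty triples. -/
private theorem card_tri (hu : Function.Injective u) (hX1 : ∀ y ∈ X, ‖y‖ = 1)
    (hX : X = Finset.univ.image u) (htri : ∀ S, S ∈ tri ↔ S.image u ∈ fanTriSets X)
    (h0 : (0 : EuclideanSpace ℝ (Fin 3)) ∈
      interior (convexHull ℝ (X : Set (EuclideanSpace ℝ (Fin 3))))) :
    tri.card = 20 := by
  have h12 : X.card = 12 := by
    rw [hX, Finset.card_image_of_injective _ hu, Finset.card_univ, Fintype.card_fin]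
  rw [← Finset.card_image_of_injective tri (Finset.image_injective hu), image_tri hX1 hX htri]
  exact card_fanTriSets h12 hX1 h0

/-- Field 3: every side of a triple lies in exactly two triples. -/
private theorem card_filter_side (hu : Function.Injective u) (hX1 : ∀ y ∈ X, ‖y‖ = 1)
    (hX : X = Finset.univ.image u) (htri : ∀ S, S ∈ tri ↔ S.image u ∈ fanTriSets X)
    (h0 : (0 : EuclideanSpace ℝ (Fin 3)) ∈
      interior (convexHull ℝ (X : Set (EuclideanSpace ℝ (Fin 3))))) :
    ∀ S ∈ tri, ∀ s ⊆ S, s.card = 2 → (tri.filter fun S' => s ⊆ S').card = 2 := by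
  intro S hS s hs h2
  rw [card_filter_tri hu hX1 hX htri s]
  exact card_filter_fanTriSets_eq_two hX1 h0 ((htri S).1 hS) (Finset.image_subset_image hs)
    (by rw [Finset.card_image_of_injective s hu, h2])

/-- Field 4: a bond (cosine `≥ 2201/4802`) is a side of exactly two triples
(the tree's `stub_bondHullEdge`). -/
private theorem card_filter_bond (hu : Function.Injective u) (hX1 : ∀ y ∈ X, ‖y‖ = 1)
    (hX : X = Finset.univ.image u) (htri : ∀ S, S ∈ tri ↔ S.image u ∈ fanTriSets X)
    (h0 : (0 : EuclideanSpace ℝ (Fin 3)) ∈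
      interior (convexHull ℝ (X : Set (EuclideanSpace ℝ (Fin 3)))))
    (hhi : ∀ k l, k ≠ l → ⟪u k, u l⟫ ≤ 2801 / 5202) {v w : Fin 12} (hvw : v ≠ w)
    (hb : 2201 / 4802 ≤ ⟪u v, u w⟫) :
    (tri.filter fun S' => ({v, w} : Finset (Fin 12)) ⊆ S').card = 2 := by
  rw [card_filter_tri hu hX1 hX htri, Finset.image_insert, Finset.image_singleton]
  refine card_filter_fanTriSets_eq_two_of_mem_hullEdges hX1 h0
    (stub_bondHullEdge X hX1 (u v) (u w) (apply_mem hX v) (apply_mem hX w) (hu.ne hvw)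
      (by linarith) ?_)
  intro y hy hyv hyw
  rw [hX] at hy
  obtain ⟨m, -, rfl⟩ := Finset.mem_image.1 hy
  have h1 := hhi v m fun h => hyv (congrArg u h).symm
  have h2 := hhi w m fun h => hyw (congrArg u h).symm
  linarith

/-- Field 5: a bonded triangle is a triple (`stub_bondTriangleFacet`: it is exactly the tight
set of a facet, hence the vertex set of the fan triangle `(c₀, 0)` of that facet). -/
private theorem triple_mem_tri (hu : Function.Injective u) (hX1 : ∀ y ∈ X, ‖y‖ = 1)
    (hX : X = Finset.univ.image u) (htri : ∀ S, S ∈ tri ↔ S.image u ∈ fanTriSets X)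
    (hhi : ∀ k l, k ≠ l → ⟪u k, u l⟫ ≤ 2801 / 5202) {a b c : Fin 12} (hab : a ≠ b)
    (hbc : b ≠ c) (hac : a ≠ c) (kab : 2201 / 4802 ≤ ⟪u a, u b⟫)
    (kbc : 2201 / 4802 ≤ ⟪u b, u c⟫) (kac : 2201 / 4802 ≤ ⟪u a, u c⟫) :
    ({a, b, c} : Finset (Fin 12)) ∈ tri := by
  obtain ⟨c₀, hc₀, htight⟩ := stub_bondTriangleFacet X hX1 (inner_le_of_mem hhi hX) (u a) (u b)
    (u c) (apply_mem hX a) (apply_mem hX b) (apply_mem hX c) (hu.ne hab) (hu.ne hbc) (hu.ne hac)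
    kab kbc kac
  have himg : ({a, b, c} : Finset (Fin 12)).image u = {u a, u b, u c} := by
    rw [Finset.image_insert, Finset.image_insert, Finset.image_singleton]
  have h3 : (tightSet X c₀).card = 3 := by
    rw [htight, ← himg, Finset.card_image_of_injective _ hu]
    exact Finset.card_eq_three.2 ⟨a, b, c, hab, hac, hbc, rfl⟩
  have hp : (c₀, 0) ∈ fanTriangles X :=
    mem_fanTriangles.2 ⟨hc₀, by change 0 + 2 < (tightSet X c₀).card; omega⟩
  have heq : fanVerts X (c₀, 0) = tightSet X c₀ :=
    Finset.eq_of_subset_of_card_le (fanVerts_subset_tightSet hX1 hp)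
      (h3.trans (fanVerts_card hX1 hp).symm).le
  rw [htri, himg, ← htight]
  exact mem_fanTriSets.2 ⟨(c₀, 0), hp, heq⟩

/-- Field 6: the link of a label is connected (closure form), from `fanTriSets_link`. -/
private theorem link_tri (hu : Function.Injective u) (hX1 : ∀ y ∈ X, ‖y‖ = 1)
    (hX : X = Finset.univ.image u) (htri : ∀ S, S ∈ tri ↔ S.image u ∈ fanTriSets X)
    (h0 : (0 : EuclideanSpace ℝ (Fin 3)) ∈
      interior (convexHull ℝ (X : Set (EuclideanSpace ℝ (Fin 3)))))
    (v : Fin 12) (A : Finset (Finset (Fin 12))) (hA : A ⊆ tri.filter fun S => v ∈ S)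
    (hne : A.Nonempty)
    (hcl : ∀ S ∈ A, ∀ S' ∈ tri, v ∈ S' → (S ∩ S').card = 2 → S' ∈ A) :
    A = tri.filter fun S => v ∈ S := by
  have key : A.image (Finset.image u) = (fanTriSets X).filter fun T => u v ∈ T := by
    refine fanTriSets_link hX1 h0 ?_ (hne.image _) ?_
    · intro T hT
      obtain ⟨S, hS, rfl⟩ := Finset.mem_image.1 hT
      obtain ⟨hS1, hS2⟩ := Finset.mem_filter.1 (hA hS)
      exact Finset.mem_filter.2 ⟨(htri S).1 hS1, hu.mem_finset_image.2 hS2⟩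
    · intro T hT T' hT' hvT' h2
      obtain ⟨S, hS, rfl⟩ := Finset.mem_image.1 hT
      obtain ⟨S', hS', rfl⟩ := exists_image_eq_of_mem hX1 hX htri hT'
      rw [← Finset.image_inter _ _ hu, Finset.card_image_of_injective _ hu] at h2
      exact Finset.mem_image_of_mem _ (hcl S hS S' hS' (hu.mem_finset_image.1 hvT') h2)
  refine Finset.Subset.antisymm hA fun S hS => ?_
  obtain ⟨hS1, hS2⟩ := Finset.mem_filter.1 hS
  have hSA : S.image u ∈ A.image (Finset.image u) := by
    rw [key]
    exact Finset.mem_filter.2 ⟨(htri S).1 hS1, hu.mem_finset_image.2 hS2⟩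
  obtain ⟨S₀, hS₀, he⟩ := Finset.mem_image.1 hSA
  exact Finset.image_injective hu he ▸ hS₀

end Transport

/-! ### The theorem -/

/-- **Dictionary, structural part (unit code → labelled fan triangulation).**  For an injective bonded unit code `u`
with the two cosine bounds and `0` interior to its hull, the fan triangles `fanTriSets X` of `X = {u k}` pulled back to
label triples `tri`: three labels per triple, twenty triples, every side in exactly two triples, every bond a side of
exactly two triples, every bonded triangle a triple, and connected vertex links. -/
theorem fanStruct_of_code (u : Fin 12 → EuclideanSpace ℝ (Fin 3)) (hu1 : ∀ k, ‖u k‖ = 1)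
    (hu : Function.Injective u) (bond : Fin 12 → Fin 12 → Prop)
    (hhi : ∀ k l, k ≠ l → ⟪u k, u l⟫ ≤ 2801 / 5202) (hlo : ∀ k l, bond k l → 2201 / 4802 ≤ ⟪u k, u l⟫)
    (h0 : (0 : EuclideanSpace ℝ (Fin 3)) ∈ interior (convexHull ℝ (Set.range u))) :
    let X : Finset (EuclideanSpace ℝ (Fin 3)) := Finset.univ.image u
    let tri : Finset (Finset (Fin 12)) := Finset.univ.powerset.filter fun S => S.image u ∈ fanTriSets X
    (∀ S ∈ tri, S.card = 3) ∧ tri.card = 20 ∧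
      (∀ S ∈ tri, ∀ s ⊆ S, s.card = 2 → (tri.filter fun S' => s ⊆ S').card = 2) ∧
      (∀ v w, v ≠ w → bond v w → (tri.filter fun S' => ({v, w} : Finset (Fin 12)) ⊆ S').card = 2) ∧
      (∀ a b c, a ≠ b → b ≠ c → a ≠ c → bond a b → bond b c → bond a c →
        ({a, b, c} : Finset (Fin 12)) ∈ tri) ∧
      (∀ v, ∀ A ⊆ tri.filter (fun S => v ∈ S), A.Nonempty →
        (∀ S ∈ A, ∀ S' ∈ tri, v ∈ S' → (S ∩ S').card = 2 → S' ∈ A) → A = tri.filter fun S => v ∈ S) := by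
  intro X tri
  have hX : X = Finset.univ.image u := rfl
  have htri : ∀ S, S ∈ tri ↔ S.image u ∈ fanTriSets X := fun S =>
    Finset.mem_filter.trans (and_iff_right (Finset.mem_powerset.2 (Finset.subset_univ S)))
  have hX1 : ∀ y ∈ X, ‖y‖ = 1 := norm_eq_one_of_mem hu1 hX
  have h0' : (0 : EuclideanSpace ℝ (Fin 3)) ∈
      interior (convexHull ℝ (X : Set (EuclideanSpace ℝ (Fin 3)))) := by
    rw [hX, Finset.coe_image, Finset.coe_univ, Set.image_univ]
    exact h0
  exact ⟨card_eq_three_of_mem_tri hu hX1 htri, card_tri hu hX1 hX htri h0',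
    card_filter_side hu hX1 hX htri h0',
    fun v w hvw hb => card_filter_bond hu hX1 hX htri h0' hhi hvw (hlo v w hb),
    fun a b c hab hbc hac kab kbc kac => triple_mem_tri hu hX1 hX htri hhi hab hbc hac
      (hlo a b kab) (hlo b c kbc) (hlo a c kac),
    link_tri hu hX1 hX htri h0'⟩

/-- **`fanStruct_of_code`, equation form**: the abbreviations `X`, `tri` as explicit arguments with their defining
equations (the shape consumed by the assembly). -/
theorem fanStruct_of_code_eq (u : Fin 12 → EuclideanSpace ℝ (Fin 3)) (hu1 : ∀ k, ‖u k‖ = 1)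
    (hu : Function.Injective u) (bond : Fin 12 → Fin 12 → Prop)
    (hhi : ∀ k l, k ≠ l → ⟪u k, u l⟫ ≤ 2801 / 5202) (hlo : ∀ k l, bond k l → 2201 / 4802 ≤ ⟪u k, u l⟫)
    (h0 : (0 : EuclideanSpace ℝ (Fin 3)) ∈ interior (convexHull ℝ (Set.range u)))
    (X : Finset (EuclideanSpace ℝ (Fin 3))) (hX : X = Finset.univ.image u) (tri : Finset (Finset (Fin 12)))
    (htri : tri = Finset.univ.powerset.filter fun S => S.image u ∈ fanTriSets X) :
    (∀ S ∈ tri, S.card = 3) ∧ tri.card = 20 ∧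
      (∀ S ∈ tri, ∀ s ⊆ S, s.card = 2 → (tri.filter fun S' => s ⊆ S').card = 2) ∧
      (∀ v w, v ≠ w → bond v w → (tri.filter fun S' => ({v, w} : Finset (Fin 12)) ⊆ S').card = 2) ∧
      (∀ a b c, a ≠ b → b ≠ c → a ≠ c → bond a b → bond b c → bond a c →
        ({a, b, c} : Finset (Fin 12)) ∈ tri) ∧
      (∀ v, ∀ A ⊆ tri.filter (fun S => v ∈ S), A.Nonempty →
        (∀ S ∈ A, ∀ S' ∈ tri, v ∈ S' → (S ∩ S').card = 2 → S' ∈ A) → A = tri.filter fun S => v ∈ S) := by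
  subst htri hX
  exact fanStruct_of_code u hu1 hu bond hhi hlo h0

end Summit.AtomisticToContinuum.Crystallization.Theorems.ChargedEnergyGapChartDial

end
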